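import Literature.Geometry.Lorentzian.KerrSchildWaveCauchyProblem
import Literature.Geometry.Lorentzian.KerrSchildCoord

/-!
# Crux `AdiabaticMultiKerrILED` (line `Sketch`) — the rest-frame tails-cut zone as a
# generalised Kerr–Schild background

Helper file for the crux `stmt-FinalStateConjecture-14310`
(`Summit.FinalStateConjecture.FinalStateConjecture.Theses.ClusterCompleteness.AdiabaticMultiKerrILED`),
line `Sketch`, stub `exists_tailsCutBackground` (lead c7, wave 1).

In its rest frame one zone of the crux's patched background is the generalised Kerr–Schild field
`G = η⁻¹ − χ(r) · 2H · ℓ♯ ⊗ ℓ♯` with the TAILS-CUT factor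
`χ(r) = Real.smoothTransition (2 − r/(8M))` (`χ = 1` for `r ≤ 8M`: exact Kerr; `χ = 0` for
`r ≥ 16M`: flat). Almost every integrated energy
statement of the Literature is phrased for a `B : KerrSchild.Background` (profile `φ`, null vector
`l`, a bound, nullity and normalisation of `l` where `φ ≠ 0`, smooth inverse-metric components on
all of `ℝ⁴`); the exact Kerr chart is packaged this way as `Kerr.surgeryBackground M a r₀`, whose
profile `Kerr.surgeryProfile M a r₀ = 2 χ_{r₀}(r) H` is surgered to `0` inside `{r ≤ r₀/2}` and
equals `2H` on `{r ≥ r₀}`. This file packages the tails-cut zone in the same way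
(`exists_tailsCutBackground`): the background with

* profile `φ = χ(r) · Kerr.surgeryProfile M a r₀ ∈ [0, 4M/r₀]` (`0 ≤ χ ≤ 1`,
  `Kerr.surgeryProfile_nonneg/_le`), null vector `ℓ♯ = Kerr.nullVector a` (null with `ℓ(∂_t) = 1`
  wherever `φ ≠ 0`, since then `r > r₀/2 > 0`);
* smooth components `η^{μν} − χ(r) φ_{r₀} ℓ^μ ℓ^ν` (identically `η^{μν}` near `{r ≤ r₀/2}`, a
  product of smooth functions on `{r > r₀/4} ⊆ {r > 0}` — `Kerr.contDiff_of_eq_zero_of_radius_lt`);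
* **stationary** inverse metric, `G^{μν}(x + t ∂₀) = G^{μν}(x)` (`r`, `H`, `ℓ♯` do not depend on
  `x⁰`), hence `∂₀ G^{μν} = 0` everywhere
  (`fderiv_background_inverseMetric_basisVector_zero_of_invariant`: a smooth function constant
  along the line `t ↦ x + t ∂₀` has vanishing derivative in the direction `∂₀`);
* on `{r ≥ r₀}` (where `φ_{r₀} = 2H`, `Kerr.surgeryProfile_eq_of_le`) its inverse metric IS the
  tails-cut field `KerrSchild.inverseMetric (χ · 2H) ℓ♯` of the crux.

Kerr–Schild 1965, §2 (the Kerr–Schild form and its stationarity); Choquet-Bruhat–Cotsakis 2002, §2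
(regular slicings: bounded profile). [folklore]
-/

noncomputable section

-- the doubled `FinalStateConjecture.FinalStateConjecture` path component trips dupNamespace
set_option linter.dupNamespace false

open scoped ContDiff Topology
open Literature.Geometry.Lorentzian

namespace Summit.FinalStateConjecture.FinalStateConjecture.Theorems

/-! ### The surgered tails-cut profile `χ(r) · φ_{r₀}` -/

/-- `0 ≤ χ(r) φ_{r₀}` for `M ≥ 0` (`χ ≥ 0`, `φ_{r₀} ≥ 0`). [folklore] -/
theorem tailsCutSurgeryProfile_nonneg {M : ℝ} (hM : 0 ≤ M) (a r₀ : ℝ) (x : E4) :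
    0 ≤ Real.smoothTransition (2 - Kerr.radius a x / (8 * M)) * Kerr.surgeryProfile M a r₀ x :=
  mul_nonneg (Real.smoothTransition.nonneg _) (Kerr.surgeryProfile_nonneg hM a r₀ x)

/-- `χ(r) φ_{r₀} ≤ 4M/r₀` for `M ≥ 0`, `r₀ > 0` (`χ ≤ 1`, `0 ≤ φ_{r₀} ≤ 4M/r₀`,
`Kerr.surgeryProfile_le`). [folklore] -/
theorem tailsCutSurgeryProfile_le {M : ℝ} (hM : 0 ≤ M) (a : ℝ) {r₀ : ℝ} (hr₀ : 0 < r₀) (x : E4) :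
    Real.smoothTransition (2 - Kerr.radius a x / (8 * M)) * Kerr.surgeryProfile M a r₀ x ≤
      4 * M / r₀ :=
  (mul_le_of_le_one_left (Kerr.surgeryProfile_nonneg hM a r₀ x)
    (Real.smoothTransition.le_one _)).trans (Kerr.surgeryProfile_le hM a hr₀ x)

/-- Where `χ(r) φ_{r₀} ≠ 0` one has `φ_{r₀} ≠ 0`, so `r > r₀/2 > 0`
(`Kerr.lt_radius_of_surgeryProfile_ne_zero`). [folklore] -/
theorem radius_pos_of_tailsCutSurgeryProfile_ne_zero {M a r₀ : ℝ} (hr₀ : 0 < r₀) {x : E4}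
    (hx : Real.smoothTransition (2 - Kerr.radius a x / (8 * M)) * Kerr.surgeryProfile M a r₀ x
      ≠ 0) :
    0 < Kerr.radius a x :=
  lt_trans (half_pos hr₀)
    (Kerr.lt_radius_of_surgeryProfile_ne_zero hr₀ (mul_ne_zero_iff.mp hx).2)

/-- The surgered tails-cut profile does not depend on `x⁰` (`r` and `H` are invariant under
`x ↦ x + t ∂₀`: `Kerr.radius_add_time_smul_basisVector`, `Kerr.scalarH_add_smul_basisVector_zero`).
Kerr–Schild 1965, §2. [folklore] -/
theorem tailsCutSurgeryProfile_add_smul_basisVector_zero (M a r₀ : ℝ) (x : E4) (t : ℝ) :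
    Real.smoothTransition (2 - Kerr.radius a (x + t • E4.basisVector 0) / (8 * M)) *
        Kerr.surgeryProfile M a r₀ (x + t • E4.basisVector 0) =
      Real.smoothTransition (2 - Kerr.radius a x / (8 * M)) * Kerr.surgeryProfile M a r₀ x := by
  simp only [Kerr.surgeryProfile, Kerr.radius_add_time_smul_basisVector,
    Kerr.scalarH_add_smul_basisVector_zero]

/-- **The inverse-metric components `η^{μν} − χ(r) φ_{r₀} ℓ^μ ℓ^ν` of the surgered tails-cut
field are smooth on all of `ℝ⁴`** (`r₀ > 0`): identically `η^{μν}` on `{r < r₀/2}`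
(`Kerr.surgeryProfile_eq_zero_of_le`), and on `{r > r₀/4} ⊆ {r > 0}` a product of the smooth
functions `χ ∘ (2 − r/(8M))` (`Kerr.contDiffAt_radius`, `Real.smoothTransition.contDiff`),
`φ_{r₀}` (`Kerr.contDiff_surgeryProfile`) and `ℓ^μ`, `ℓ^ν` (`Kerr.contDiffAt_nullVector`); glued by
`Kerr.contDiff_of_eq_zero_of_radius_lt`. Model: `Kerr.contDiff_inverseMetric_surgeryProfile`.
[folklore] -/
theorem contDiff_inverseMetric_tailsCutSurgeryProfile (M a : ℝ) {r₀ : ℝ} (hr₀ : 0 < r₀)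
    (μ ν : Fin 4) {n : ℕ∞} :
    ContDiff ℝ n fun x ↦ KerrSchild.inverseMetric
      (fun y ↦ Real.smoothTransition (2 - Kerr.radius a y / (8 * M)) * Kerr.surgeryProfile M a r₀ y)
      (Kerr.nullVector a) x μ ν := by
  have h : (fun x ↦ KerrSchild.inverseMetric
      (fun y ↦ Real.smoothTransition (2 - Kerr.radius a y / (8 * M)) * Kerr.surgeryProfile M a r₀ y)
      (Kerr.nullVector a) x μ ν) =
      fun x ↦ Kerr.etaComp μ ν - Real.smoothTransition (2 - Kerr.radius a x / (8 * M)) *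
        Kerr.surgeryProfile M a r₀ x * Kerr.nullVector a x μ * Kerr.nullVector a x ν := rfl
  rw [h]
  refine contDiff_const.sub ?_
  refine Kerr.contDiff_of_eq_zero_of_radius_lt (a := a) (c := r₀ / 2) (by positivity)
    (fun x hx ↦ by
      rw [Kerr.surgeryProfile_eq_zero_of_le hr₀ hx.le, mul_zero, zero_mul, zero_mul])
    fun x hx ↦ ?_
  have hpos : 0 < Kerr.radius a x := by linarith
  have hV : ∀ κ, ContDiffAt ℝ (n : WithTop ℕ∞) (fun y ↦ Kerr.nullVector a y κ) x :=
    fun κ ↦ contDiffAt_euclidean.mp (Kerr.contDiffAt_nullVector a hpos) κ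
  have hχ : ContDiffAt ℝ (n : WithTop ℕ∞)
      (fun y ↦ Real.smoothTransition (2 - Kerr.radius a y / (8 * M))) x :=
    Real.smoothTransition.contDiff.contDiffAt.comp x
      (contDiffAt_const.sub ((Kerr.contDiffAt_radius hpos).div_const _))
  have hφ : ContDiffAt ℝ (n : WithTop ℕ∞) (Kerr.surgeryProfile M a r₀) x :=
    (Kerr.contDiff_surgeryProfile M a hr₀).contDiffAt
  exact ((hχ.mul hφ).mul (hV μ)).mul (hV ν)

/-! ### Stationary backgrounds: `∂₀ g^{μν} = 0` -/

/-- **On a generalised Kerr–Schild background whose inverse metric is invariant under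
`x ↦ x + t ∂₀`, `∂₀ g^{μν} = 0` everywhere**: the component `g^{μν}` is differentiable (it is
smooth, `B.contDiff_inverseMetric`) and constant along the line `t ↦ x + t ∂₀`, so its derivative
in the direction `∂₀` vanishes (uniqueness of the line derivative). Model:
`Kerr.fderiv_inverseMetric_basisVector_zero`. Kerr–Schild 1965, §2. [folklore] -/
theorem fderiv_background_inverseMetric_basisVector_zero_of_invariant (B : KerrSchild.Background)
    (hB : ∀ (x : E4) (t : ℝ) (μ ν : Fin 4),
      B.inverseMetric (x + t • E4.basisVector 0) μ ν = B.inverseMetric x μ ν)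
    (x : E4) (μ ν : Fin 4) :
    fderiv ℝ (fun y ↦ B.inverseMetric y μ ν) x (E4.basisVector 0) = 0 := by
  set g : E4 → ℝ := fun y ↦ B.inverseMetric y μ ν with hg
  have hgd : DifferentiableAt ℝ g x :=
    ((B.contDiff_inverseMetric μ ν).differentiable (by simp)).differentiableAt
  have h1 : HasDerivAt (fun t : ℝ ↦ g (x + t • E4.basisVector 0))
      (fderiv ℝ g x (E4.basisVector 0)) 0 :=
    hgd.hasFDerivAt.hasLineDerivAt (E4.basisVector 0)
  have hconst : (fun t : ℝ ↦ g (x + t • E4.basisVector 0)) = fun _ ↦ g x :=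
    funext fun t ↦ hB x t μ ν
  rw [hconst] at h1
  exact h1.unique (hasDerivAt_const 0 (g x))

/-! ### The tails-cut background -/

/-- **The rest-frame tails-cut zone as a generalised Kerr–Schild background** (`M ≥ 0`, `r₀ > 0`):
there is a `KerrSchild.Background` with null vector `ℓ♯ = Kerr.nullVector a` and profile
`φ = χ(r) · Kerr.surgeryProfile M a r₀`, `χ(r) = Real.smoothTransition (2 − r/(8M))`, whose inverse
metric is stationary (`G(x + t ∂₀) = G(x)`, hence `∂₀ G^{μν} = 0` everywhere) and coincides on
`{r ≥ r₀}` with the tails-cut Kerr–Schild field `η^{μν} − χ(r) · 2H · ℓ^μ ℓ^ν` of the crux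
(`Kerr.surgeryProfile_eq_of_le`: `φ_{r₀} = 2H` there). The bound is `4M/r₀`; nullity and
normalisation of `ℓ♯` hold wherever `φ ≠ 0` since then `r > r₀/2 > 0` (`Kerr.bilin_nullVector`,
`Kerr.nullCovector_nullVector`, `Kerr.nullCovector_basisVector_zero`); smoothness is
`contDiff_inverseMetric_tailsCutSurgeryProfile`. Kerr–Schild 1965, §2; Choquet-Bruhat–Cotsakis
2002, §2. [folklore] -/
theorem exists_tailsCutBackground : ∀ (M a r₀ : ℝ), 0 ≤ M → 0 < r₀ →
    ∃ B : KerrSchild.Background, B.l = Kerr.nullVector a ∧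
      (∀ x, B.φ x =
        Real.smoothTransition (2 - Kerr.radius a x / (8 * M)) * Kerr.surgeryProfile M a r₀ x) ∧
      (∀ (x : E4) (t : ℝ) (μ ν : Fin 4),
        B.inverseMetric (x + t • E4.basisVector 0) μ ν = B.inverseMetric x μ ν) ∧
      (∀ (x : E4) (μ ν : Fin 4),
        fderiv ℝ (fun y ↦ B.inverseMetric y μ ν) x (E4.basisVector 0) = 0) ∧
      ∀ x : E4, r₀ ≤ Kerr.radius a x → ∀ μ ν, B.inverseMetric x μ ν =
        KerrSchild.inverseMetric
          (fun y ↦ Real.smoothTransition (2 - Kerr.radius a y / (8 * M)) * (2 * Kerr.scalarH M a y))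
          (Kerr.nullVector a) x μ ν := by
  intro M a r₀ hM hr₀
  let B : KerrSchild.Background :=
    { φ := fun x ↦
        Real.smoothTransition (2 - Kerr.radius a x / (8 * M)) * Kerr.surgeryProfile M a r₀ x
      l := Kerr.nullVector a
      bound := 4 * M / r₀
      φ_nonneg := tailsCutSurgeryProfile_nonneg hM a r₀
      φ_le := tailsCutSurgeryProfile_le hM a hr₀
      null := fun x hx ↦ by
        rw [Kerr.bilin_nullVector,
          Kerr.nullCovector_nullVector (radius_pos_of_tailsCutSurgeryProfile_ne_zero hr₀ hx)]
      normalised := fun x _ ↦ by rw [Kerr.bilin_nullVector, Kerr.nullCovector_basisVector_zero]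
      contDiff_inverseMetric := fun μ ν ↦
        contDiff_inverseMetric_tailsCutSurgeryProfile M a hr₀ μ ν }
  have hstat : ∀ (x : E4) (t : ℝ) (μ ν : Fin 4),
      B.inverseMetric (x + t • E4.basisVector 0) μ ν = B.inverseMetric x μ ν := by
    intro x t μ ν
    simp only [B, KerrSchild.Background.inverseMetric, KerrSchild.inverseMetric,
      tailsCutSurgeryProfile_add_smul_basisVector_zero, Kerr.nullVector_add_smul_basisVector_zero]
  refine ⟨B, rfl, fun x ↦ rfl, hstat,
    fderiv_background_inverseMetric_basisVector_zero_of_invariant B hstat, ?_⟩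
  intro x hx μ ν
  simp only [B, KerrSchild.Background.inverseMetric, KerrSchild.inverseMetric,
    Kerr.surgeryProfile_eq_of_le hr₀ hx]

end Summit.FinalStateConjecture.FinalStateConjecture.Theorems

end
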